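import Mathlib
import Literature.NumberTheory.LFunctions.Zhang2022.SkeletonPartOne
import Literature.NumberTheory.LFunctions.Zhang2022.SkeletonAssembly
import Literature.NumberTheory.LFunctions.Zhang2022.SkeletonPartOneC
import Literature.NumberTheory.LFunctions.Zhang2022.Section4Prop22Mechanism
import HarnessLib

/-!
# Zhang (2022), typed skeleton: the §4 deduction of Proposition 2.2 from Lemmas 4.2, 4.5, 4.6, 4.7,
# kernel-checked over the REPAIRED antecedents (DAG node `Z22:Ded22`; GAP row G-d15-1)

Topic `Literature/NumberTheory/LFunctions/Zhang2022` (Landau–Siegel audit tree; verdict-neutral).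
Y. Zhang, *Discrete mean estimates and the Landau–Siegel zero*, arXiv:2211.02515v1 (2022)
[Zhang2022LandauSiegel] — **an unrefereed manuscript under adjudication**; `Lemma42`, `Lemma45`,
`Lemma46 c′`, `Lemma47 c′`, `Prop22 c′`, `Ded22 c′` are the skeleton's CLAIM nodes
(`SkeletonPartOne`, `SkeletonPropositions`), stated not asserted. The manuscript deduces
Proposition 2.2 — for `ψ ∈ Ψ₁`: (i) the zeros of `L(s,ψ)L(s,ψχ)` in `Ω` lie on `σ = 1/2`, (ii) they
are simple, (iii) consecutive ones satisfy `|γ′ − γ − α| < c′α²𝓛` — in two sentences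
(§4, PDF p. 23, tex L1263–L1264):

> Lemma 4.5 and 4.6 together imply the assertions (i) and (ii) of Proposition 2.2. It is also
> proved that the gap between any distinct zeros of `𝒜(s,ψ)` in `Ω` is `> α(1 − c′α𝓛)`. To complete
> the proof of the gap assertion (iii), it now suffices to prove [Lemma 4.7].

The skeleton types this deduction as the claim `Ded22 c′ : Lemma42 → Lemma45 → Lemma46 c′ →
Lemma47 c′ → Prop22 c′`. **As typed it does not follow formally from its antecedents** (GAP row
G-d15-1 of the campaign ledger, class in-cone / repairable), for three one-token reasons:
(s1) the seam `σ = 1/2 + α²` is in neither Lemma 4.5's printed range `1/2 + α² < σ < 1` nor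
Lemma 4.6's `1/2 ≤ β < 1/2 + α²` (Team R's certificate `AdjTeamR.ded22_printed_split_incomplete`;
Lemma 4.5's own proof, Case 2, is headed "`1/2 + α² ≤ σ`", tex L1175); (s2) Lemmas 4.5–4.7 are
printed on the window `|t − 2πt₀| < 𝓛₁ + 2`, which is `Ω`'s own, so the two companion zeros that
Lemma 4.7 places within `α(1 + c′α𝓛)` of a zero of `Ω` close to its horizontal edges are controlled
by no typed hypothesis (their proofs use (4.10)/(4.11) on `Ω₃`/`Ω₂`, windows `𝓛₁ + 3`/`𝓛₁ + 4`, with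
`|w| < 2α`, so the window `𝓛₁ + 5/2` costs nothing); (s3) Lemma 4.6 (iii) is printed with the OPEN
punctured disc `0 < |w| < α(1 − c′α𝓛)`, which cannot give the STRICT inequality of (iii) at the
same `c′` (also observed by seat d02 of the campaign) — the manuscript's separate remark
"gap `> α(1 − c′α𝓛)`" is the closed-disc form, which its Rouché argument (no zeros on the circle)
supplies; alternatively (iii) holds with any `c″ > c′`.

This file PROVES the deduction over the repaired antecedents, spelled out inline as hypotheses
(no new definitions; GAP row G-d15-1 names them `Lemma45R`, `Lemma46R c′`; Lemma 4.7 enters AS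
PRINTED, the node `Lemma47 c′`):

* `prop22_of_repaired` — **`Lemma42 → Lemma45R → Lemma46R c′ → Lemma47 c′ → Prop22 c′`**, where
  `Lemma45R` is Lemma 4.5 with the CLOSED range `1/2 + α² ≤ σ < 1` and `Lemma46R c′` is Lemma 4.6
  with the CLOSED punctured disc `0 < |w| ≤ α(1 − c′α𝓛)`, both on the window
  `|t − 2πt₀| < 𝓛₁ + 5/2`, and `Lemma47 c′` is the banked node AS PRINTED (Lemma 4.7 is only ever
  applied at zeros of `Ω`); for every real `c′` (no sign or size condition: the thresholds
  `𝓛 ≥ 3π|c′| + 4 + 2max(C₄₂, 1)` are absorbed by `ForAllLarge`, `edge_thresholds`);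
* `prop22_of_repaired_open` — the same with Lemma 4.6 (iii) AS PRINTED (open punctured disc, on
  the window `𝓛₁ + 5/2`): **`… → ∀ c″ > c′, Prop22 c″`** (repair (b) of seam (s3));
* `lemma45_of_repaired`, `lemma46_of_repaired` — the repaired forms imply the banked nodes
  `Lemma45`, `Lemma46 c′` (weakening), so an analytic proof of the R-forms discharges both;
* the mechanism (file `Zhang2022/Section4Prop22Mechanism`), kernel lemmas over one `D`, one `ψ`:
  `re_eq_half_of_LL_eq_zero`
  ((i): zeros with `β < 1/2` are reflected to `1 − ρ̄` by `LL_one_sub_conj_eq_zero` — the tree's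
  `LFunction_one_sub_conj_eq_zero` for the primitive `ψ (mod p)` and `ψχ (mod Dp)`,
  `psiChiPrimitive_holds` — then `β ≥ 1/2 + α²` contradicts 4.5 and `1/2 ≤ β < 1/2 + α²` gives
  `β = 1/2` by 4.6; note `Ω ⊄ Ω₁`, so "`𝒜` has the same zeros as `L(s,ψ)L(s,ψχ)`" is only used at
  `σ ≥ 1/2`, after reflecting); `deriv_LL_ne_zero` ((ii): `𝒜′(ρ) = (LL)′(ρ)/F(ρ)` at a zero);
  `companion_facts`, `gap_lt_of_three_zeros`, `gap_gt_of_punctured_disc` ((iii): for consecutive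
  zeros `ρ, ρ′ ∈ Ω`, Lemma 4.7's three zeros `ρ + w`, `|w| < R₊ = α(1 + c′α𝓛)`, are `0` and two
  purely imaginary `w` (on the line by (i) on the wider window) of modulus in `(R₋, R₊)`,
  `R₋ = α(1 − c′α𝓛)`; both below `ρ` is impossible by 4.6 (iii) at the upper one since
  `R₊ − R₋ = 2c′α²𝓛 ≤ R₋`; so one lies above `ρ`, strictly between `ρ` and `ρ′` unless
  `γ′ − γ < R₊`; then `i(γ′ − γ)` is one of the three and `γ′ − γ > R₋` by the closed disc; and
  `R₋ < γ′ − γ < R₊` is `|γ′ − γ − α| < c′α²𝓛`).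

What is NOT asserted: Lemmas 4.2, 4.5, 4.6, 4.7 in any form (CLAIM nodes; the R-forms are
hypotheses), hence not Proposition 2.2; and not the typed `Ded22 c′` itself (it stays a CLAIM node
carrying GAP row G-d15-1). Nothing about Theorems 1–2 of the source is stated or implied; nothing
here bears on the cell's verdict on (8.24).

## References

* Y. Zhang, arXiv:2211.02515v1 (2022), §2 Proposition 2.2 (PDF p. 7, tex L406–L421; restated
  (iii) tex L463), §4 Lemmas 4.2, 4.5–4.7 and the deduction p. 23 (tex L1129–L1277).
  [cite: Zhang2022LandauSiegel, §4 p. 23]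
* H. L. Montgomery, R. C. Vaughan, *Multiplicative Number Theory I* (2007), §10.1 (reflection of
  zeros under `ρ ↦ 1 − ρ̄`; the tree's `DirichletLFunctionZeroReflection`).
  [cite: MontgomeryVaughan2007, §10.1]
-/

noncomputable section

open Complex Real ComplexConjugate

namespace Literature.NumberTheory.LFunctions.Zhang2022.Skeleton

/-- For `D ≥ ⌈e^M⌉`, `𝓛 = log D ≥ M` (local copy of `Skeleton.le_ell_of_ceil_exp_le`).
[cite: Zhang2022LandauSiegel, §2 p. 4] -/
private theorem le_ell_of_ceil_exp_le' {D : ℕ} {M : ℝ} (hD : ⌈Real.exp M⌉₊ ≤ D) :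
    M ≤ ell D := by
  have h : Real.exp M ≤ D := le_trans (Nat.le_ceil _) (by exact_mod_cast hD)
  rw [ell]
  exact (Real.le_log_iff_exp_le (lt_of_lt_of_le (Real.exp_pos _) h)).mpr h

/-! ## The edge: Proposition 2.2 from Lemma 4.2 and the repaired Lemmas 4.5, 4.6, 4.7 -/

/-- The "`D` sufficiently large" bookkeeping of the edge: from `𝓛 ≥ M := 3π|c′| + 4 + 2max(C₄₂,1)`
(and `D ≥ ⌈e^M⌉`): `D ≥ 3`, `𝓛 ≥ 4`, `α > 0`, the radii bounds, `2α ≤ (100𝓛)⁻¹ ≤ log𝓛/(100𝓛)`, and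
`C₄₂𝓛⁻²²⁷ ≤ 1/2`. [cite: Zhang2022LandauSiegel, §2 p. 4] -/
theorem edge_thresholds {c' C₂ : ℝ} {D : ℕ} [NeZero D]
    (hD : ⌈Real.exp (3 * Real.pi * |c'| + 4 + 2 * max C₂ 1)⌉₊ ≤ D) :
    3 ≤ D ∧ 0 < alpha D ∧ 0 < ell D ∧
      alpha D * (1 + c' * alpha D * ell D) - alpha D * (1 - c' * alpha D * ell D)
        ≤ alpha D * (1 - c' * alpha D * ell D) ∧
      alpha D * (1 + c' * alpha D * ell D) < 1 / 2 ∧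
      alpha D * (1 + c' * alpha D * ell D) ≤ Real.log (ell D) / (100 * ell D) ∧
      0 < Real.log (ell D) / (100 * ell D) ∧
      C₂ * (ell D ^ 227)⁻¹ ≤ 1 / 2 := by
  set M : ℝ := 3 * Real.pi * |c'| + 4 + 2 * max C₂ 1 with hM_def
  have hM : M ≤ ell D := le_ell_of_ceil_exp_le' hD
  have hmax : 1 ≤ max C₂ 1 := le_max_right _ _
  have habs : 0 ≤ |c'| := abs_nonneg _
  have hπ : 0 < Real.pi := Real.pi_pos
  have hℓ4 : 4 ≤ ell D := by nlinarith
  have hℓ1 : 1 ≤ ell D := by linarith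
  have hℓ0 : 0 < ell D := by linarith
  have hc : 3 * Real.pi * |c'| ≤ ell D := by nlinarith
  have hD3 : 3 ≤ D := by
    have hexp : Real.exp M ≤ D := le_trans (Nat.le_ceil _) (by exact_mod_cast hD)
    have hM4 : (4 : ℝ) ≤ M := by rw [hM_def]; nlinarith
    have h3 : (3 : ℝ) ≤ D := by
      have := Real.add_one_le_exp M
      linarith
    exact_mod_cast h3
  have hα : 0 < alpha D := alpha_pos hD3
  have hcαℓ := abs_mul_alpha_mul_ell_le hℓ1 hc
  obtain ⟨hRp, -, hRR, -⟩ := radii_bounds hα hℓ0 hcαℓ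
  have h2α := two_alpha_le hℓ4
  have hlogℓ : 1 ≤ Real.log (ell D) := by
    rw [Real.le_log_iff_exp_le hℓ0]
    exact le_trans Real.exp_one_lt_d9.le (by linarith)
  have h100 : 1 / (100 * ell D) ≤ Real.log (ell D) / (100 * ell D) :=
    div_le_div_of_nonneg_right hlogℓ (by positivity)
  have h400 : 1 / (100 * ell D) ≤ 1 / 400 := by
    rw [div_le_div_iff₀ (by positivity) (by norm_num)]
    linarith
  have h227 : C₂ * (ell D ^ 227)⁻¹ ≤ 1 / 2 := by
    have h1 : ell D ≤ ell D ^ 227 := le_self_pow₀ hℓ1 (by norm_num)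
    have h3 : C₂ ≤ max C₂ 1 := le_max_left _ _
    rw [← div_eq_mul_inv, div_le_iff₀ (by positivity)]
    nlinarith
  exact ⟨hD3, hα, hℓ0, hRR, by linarith, by linarith, by positivity, h227⟩

/-- **(i) and (ii) at one `D`**: for `ψ ∈ Ψ₁`, with `F ≠ 0` on `Ω₁` (Lemma 4.2), the repaired
Lemma 4.5 and the first two assertions of Lemma 4.6 (window `𝓛₁ + 5/2`), every zero of
`L(s,ψ)L(s,ψχ)` in the window with `0 < σ < 1` is on the line, and every zero in `Ω` is simple.
[cite: Zhang2022LandauSiegel, §4 p. 23, tex L1263] -/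
theorem parts_i_ii_of_pointwise {D : ℕ} [NeZero D] {χ : DirichletCharacter ℂ D} {x : Chr D}
    (hD : 3 ≤ D) (hp : χ.IsPrimitive) (hlogpos : 0 < Real.log (ell D) / (100 * ell D))
    (hF0 : ∀ s ∈ Omega1 D, Fpoly χ x s ≠ 0)
    (h45D : ∀ s : ℂ, 1 / 2 + alpha D ^ 2 ≤ s.re → s.re < 1 →
      |s.im - 2 * π * t0 D| < ell1 D + 5 / 2 → calA χ x s ≠ 0)
    (h46D : ∀ ρ : ℂ, calA χ x ρ = 0 → 1 / 2 ≤ ρ.re → ρ.re < 1 / 2 + alpha D ^ 2 →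
      |ρ.im - 2 * π * t0 D| < ell1 D + 5 / 2 → ρ.re = 1 / 2 ∧ deriv (calA χ x) ρ ≠ 0) :
    (∀ z : ℂ, 0 < z.re → z.re < 1 → |z.im - 2 * π * t0 D| < ell1 D + 5 / 2 →
      LL χ x z = 0 → z.re = 1 / 2) ∧
    (∀ s ∈ prodZeroSetOmega χ x, s.re = 1 / 2) ∧
    (∀ s ∈ prodZeroSetOmega χ x,
      deriv (fun w => x.ψ.LFunction w * (psiChi χ x).LFunction w) s ≠ 0) := by
  have hα : 0 < alpha D := alpha_pos hD
  have hline : ∀ z : ℂ, 0 < z.re → z.re < 1 → |z.im - 2 * π * t0 D| < ell1 D + 5 / 2 →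
      LL χ x z = 0 → z.re = 1 / 2 :=
    fun z h0 h1 hw hz =>
      re_eq_half_of_LL_eq_zero h45D (fun ρ hA h1' h2' hw' => (h46D ρ hA h1' h2' hw').1)
        (fun s hs hz' => LL_one_sub_conj_eq_zero hD hp x hs hz') h0 h1 hw hz
  have partI : ∀ s ∈ prodZeroSetOmega χ x, s.re = 1 / 2 := by
    intro s hs
    obtain ⟨hsΩ, hsz⟩ := hs
    obtain ⟨hre, him⟩ := (mem_Omega_iff' s).mp hsΩ
    obtain ⟨hre1, hre2⟩ := abs_lt.mp hre
    obtain ⟨him1, him2⟩ := abs_lt.mp him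
    exact hline s (by linarith) (by linarith) (by rw [abs_lt]; constructor <;> linarith) hsz
  refine ⟨hline, partI, fun s hs => ?_⟩
  have hsre := partI s hs
  obtain ⟨hsΩ, hsz⟩ := hs
  obtain ⟨-, him⟩ := (mem_Omega_iff' s).mp hsΩ
  obtain ⟨him1, him2⟩ := abs_lt.mp him
  have hΩ1 : s ∈ Omega1 D := by
    rw [Omega1, Lemma43.mem_Omega1_iff]
    refine ⟨by linarith, by linarith, ?_⟩
    rw [abs_lt]
    constructor <;> linarith
  have hF := hF0 s hΩ1
  have hz : LL χ x s = 0 := hsz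
  have hA : calA χ x s = 0 := by
    simp only [calA, hz, zero_div]
  obtain ⟨-, hA'⟩ := h46D s hA hsre.symm.le (by rw [hsre]; nlinarith)
    (by rw [abs_lt]; constructor <;> linarith)
  exact deriv_LL_ne_zero hD hp hF hz hA'

/-- **(iii) at one `D`, two-sided**: for `ψ ∈ Ψ₁` and consecutive zeros `ρ, ρ′` of `L(s,ψ)L(s,ψχ)` in
`Ω`, `R₋ ≤ γ′ − γ < R₊` from Lemma 4.7 (as printed: it is applied at `ρ ∈ Ω` only) and the PRINTED
(open-disc) third assertion of Lemma 4.6 on the window `𝓛₁ + 5/2`, and `R₋ < γ′ − γ` if the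
punctured disc is CLOSED.
[cite: Zhang2022LandauSiegel, §4 p. 23, tex L1263–L1264] -/
theorem part_iii_of_pointwise {D : ℕ} [NeZero D] {χ : DirichletCharacter ℂ D} {x : Chr D} {c' : ℝ}
    (hα : 0 < alpha D)
    (hRR : alpha D * (1 + c' * alpha D * ell D) - alpha D * (1 - c' * alpha D * ell D)
      ≤ alpha D * (1 - c' * alpha D * ell D))
    (hR_half : alpha D * (1 + c' * alpha D * ell D) < 1 / 2)
    (hR_log : alpha D * (1 + c' * alpha D * ell D) ≤ Real.log (ell D) / (100 * ell D))
    (hF0 : ∀ z ∈ Omega1 D, Fpoly χ x z ≠ 0)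
    (hline : ∀ z : ℂ, 0 < z.re → z.re < 1 → |z.im - 2 * π * t0 D| < ell1 D + 5 / 2 →
      LL χ x z = 0 → z.re = 1 / 2)
    (hI : ∀ s ∈ prodZeroSetOmega χ x, s.re = 1 / 2)
    (h46disc : ∀ ρ : ℂ, calA χ x ρ = 0 → 1 / 2 ≤ ρ.re → ρ.re < 1 / 2 + alpha D ^ 2 →
      |ρ.im - 2 * π * t0 D| < ell1 D + 5 / 2 →
        ∀ w : ℂ, 0 < ‖w‖ → ‖w‖ < alpha D * (1 - c' * alpha D * ell D) → calA χ x (ρ + w) ≠ 0)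
    (h47D : ∀ ρ : ℂ, calA χ x ρ = 0 → ρ.re = 1 / 2 → |ρ.im - 2 * π * t0 D| < ell1 D + 2 →
      {w : ℂ | ‖w‖ < alpha D * (1 + c' * alpha D * ell D) ∧ calA χ x (ρ + w) = 0}.ncard = 3)
    {s s' : ℂ} (hs : s ∈ prodZeroSetOmega χ x) (hs' : s' ∈ prodZeroSetOmega χ x)
    (hlt : s.im < s'.im)
    (hcons : ∀ s'' ∈ prodZeroSetOmega χ x, ¬ (s.im < s''.im ∧ s''.im < s'.im)) :
    (alpha D * (1 - c' * alpha D * ell D) ≤ s'.im - s.im ∧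
      s'.im - s.im < alpha D * (1 + c' * alpha D * ell D)) ∧
    ((∀ w : ℂ, 0 < ‖w‖ → ‖w‖ ≤ alpha D * (1 - c' * alpha D * ell D) → calA χ x (s + w) ≠ 0) →
      alpha D * (1 - c' * alpha D * ell D) < s'.im - s.im) := by
  have hsre := hI s hs
  have hs're := hI s' hs'
  obtain ⟨hsΩ, hsz⟩ := hs
  obtain ⟨hs'Ω, hs'z⟩ := hs'
  obtain ⟨-, hsim⟩ := (mem_Omega_iff' s).mp hsΩ
  obtain ⟨-, hs'im⟩ := (mem_Omega_iff' s').mp hs'Ω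
  obtain ⟨hi1, hi2⟩ := abs_lt.mp hsim
  have hz : LL χ x s = 0 := hsz
  have hz' : LL χ x s' = 0 := hs'z
  have hA : calA χ x s = 0 := by
    simp only [calA, hz, zero_div]
  have hT3 := h47D s hA hsre hsim
  have hdisc := h46disc s hA hsre.symm.le (by rw [hsre]; nlinarith)
    (by rw [abs_lt]; constructor <;> linarith)
  have hdlt : s'.im - s.im < alpha D * (1 + c' * alpha D * ell D) :=
    gap_lt_of_three_zeros hα hRR hR_half hR_log hF0 hline h46disc hT3 hsre hsim hz hs'im hlt hcons
  refine ⟨⟨?_, hdlt⟩, fun hclosed => ?_⟩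
  · exact gap_ge_of_open_punctured_disc hR_half hR_log hF0 hline hdisc hsre hsim hs're hz' hlt hdlt
  · exact gap_gt_of_punctured_disc hR_half hR_log hF0 hline hclosed hsre hsim hs're hz' hlt hdlt

/-- **`Z22:Ded22` [Z22 p.23, tex L1263–L1264] over the REPAIRED antecedents (GAP row G-d15-1)** —
"Lemma 4.5 and 4.6 together imply the assertions (i) and (ii) of Proposition 2.2 … To complete the
proof of the gap assertion (iii), it now suffices to prove Lemma 4.7": from Lemma 4.2 (the node
`Lemma42`: `FG = 1 + O(𝓛⁻²²⁷)` on `Ω₁`, whence `F ≠ 0` and "`𝒜` has the same zeros as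
`L(s,ψ)L(s,ψχ)`"), Lemmas 4.5, 4.6 in the forms `Lemma45R`, `Lemma46R c′` of GAP row G-d15-1
spelled out as the hypotheses `h45`, `h46` — Lemma 4.5 with the CLOSED range `1/2 + α² ≤ σ < 1`,
both on the window `|t − 2πt₀| < 𝓛₁ + 5/2`, Lemma 4.6 (iii) with the CLOSED punctured disc
`0 < |w| ≤ α(1 − c′α𝓛)` — and Lemma 4.7 AS PRINTED (`h47 : Lemma47 c′`), Proposition 2.2 (i),
(ii), (iii) (`Prop22 c′`, the SAME `c′`) follows for all large `D`
(`𝓛 ≥ 3π|c′| + 4 + 2max(C₄₂,1)`). (i)/(ii):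
`parts_i_ii_of_pointwise`; (iii): `part_iii_of_pointwise` (`R₋ < γ′ − γ < R₊`, `R± = α ± c′α²𝓛`).
The banked node `Ded22 c′` (antecedents AS PRINTED) is not derivable — see the module docstring.
[cite: Zhang2022LandauSiegel, §4 p. 23] -/
theorem prop22_of_repaired (c' : ℝ) (h42 : Lemma42)
    (h45 : ForAllLarge fun D _ χ => ∀ x ∈ PsiOne χ, ∀ s : ℂ,
      1 / 2 + alpha D ^ 2 ≤ s.re → s.re < 1 → |s.im - 2 * π * t0 D| < ell1 D + 5 / 2 →
        calA χ x s ≠ 0)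
    (h46 : ForAllLarge fun D _ χ => ∀ x ∈ PsiOne χ, ∀ ρ : ℂ, calA χ x ρ = 0 →
      1 / 2 ≤ ρ.re → ρ.re < 1 / 2 + alpha D ^ 2 → |ρ.im - 2 * π * t0 D| < ell1 D + 5 / 2 →
        ρ.re = 1 / 2 ∧ deriv (calA χ x) ρ ≠ 0 ∧
          ∀ w : ℂ, 0 < ‖w‖ → ‖w‖ ≤ alpha D * (1 - c' * alpha D * ell D) → calA χ x (ρ + w) ≠ 0)
    (h47 : Lemma47 c') : Prop22 c' := by
  obtain ⟨C₂, h2⟩ := h42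
  obtain ⟨D₀, hall⟩ := ((h2.and h45).and h46).and h47
  set D₁ : ℕ := max D₀ ⌈Real.exp (3 * Real.pi * |c'| + 4 + 2 * max C₂ 1)⌉₊ with hD₁
  have main : ∀ (D : ℕ) [NeZero D] (χ : DirichletCharacter ℂ D), D₁ ≤ D →
      χ.IsQuadratic → χ.IsPrimitive →
      (∀ x ∈ PsiOne χ, ∀ s ∈ prodZeroSetOmega χ x, s.re = 1 / 2) ∧
      (∀ x ∈ PsiOne χ, ∀ s ∈ prodZeroSetOmega χ x,
        deriv (fun w => x.ψ.LFunction w * (psiChi χ x).LFunction w) s ≠ 0) ∧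
      (∀ x ∈ PsiOne χ, ∀ s ∈ prodZeroSetOmega χ x, ∀ s' ∈ prodZeroSetOmega χ x, s.im < s'.im →
        (∀ s'' ∈ prodZeroSetOmega χ x, ¬ (s.im < s''.im ∧ s''.im < s'.im)) →
          |s'.im - s.im - alpha D| < c' * alpha D ^ 2 * ell D) := by
    intro D _ χ hD hq hp
    obtain ⟨⟨⟨h42D, h45D⟩, h46D⟩, h47D⟩ := hall D χ (le_trans (le_max_left _ _) hD) hq hp
    obtain ⟨hD3, hα, hℓ0, hRR, hR_half, hR_log, hlogpos, h227⟩ :=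
      edge_thresholds (c' := c') (C₂ := C₂) (le_trans (le_max_right _ _) hD)
    -- `F ≠ 0` on `Ω₁` (Lemma 4.2 with `C₄₂𝓛⁻²²⁷ ≤ 1/2`)
    have hF0 : ∀ x ∈ PsiOne χ, ∀ s ∈ Omega1 D, Fpoly χ x s ≠ 0 := by
      intro x hx s hs hF
      have h := h42D x hx s hs
      rw [hF, zero_mul, zero_sub, norm_neg, norm_one] at h
      linarith
    have hx12 : ∀ x ∈ PsiOne χ, _ := fun x hx =>
      parts_i_ii_of_pointwise (x := x) hD3 hp hlogpos (hF0 x hx) (h45D x hx)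
        (fun ρ hA h1 h2 hw => ⟨(h46D x hx ρ hA h1 h2 hw).1, (h46D x hx ρ hA h1 h2 hw).2.1⟩)
    refine ⟨fun x hx => (hx12 x hx).2.1, fun x hx => (hx12 x hx).2.2,
      fun x hx s hs s' hs' hlt hcons => ?_⟩
    obtain ⟨hline, hI, -⟩ := hx12 x hx
    have h3 := part_iii_of_pointwise hα hRR hR_half hR_log (hF0 x hx) hline hI
      (fun ρ hAρ h1 h2 hw w h0 hlt' => (h46D x hx ρ hAρ h1 h2 hw).2.2 w h0 hlt'.le)
      (h47D x hx) hs hs' hlt hcons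
    have hA : calA χ x s = 0 := by
      have hz : LL χ x s = 0 := hs.2
      simp only [calA, hz, zero_div]
    obtain ⟨-, hsim⟩ := (mem_Omega_iff' s).mp hs.1
    obtain ⟨hi1, hi2⟩ := abs_lt.mp hsim
    have hsre := hI s hs
    have hclosed := (h46D x hx s hA hsre.symm.le (by rw [hsre]; nlinarith)
      (by rw [abs_lt]; constructor <;> linarith)).2.2
    have hgt := h3.2 hclosed
    have hlt' := h3.1.2
    have e1 : alpha D * (1 + c' * alpha D * ell D) = alpha D + c' * alpha D ^ 2 * ell D := by ring
    have e2 : alpha D * (1 - c' * alpha D * ell D) = alpha D - c' * alpha D ^ 2 * ell D := by ring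
    rw [abs_lt]
    constructor <;> linarith
  exact ⟨⟨D₁, fun D _ χ hD hq hp => (main D χ hD hq hp).1⟩,
    ⟨D₁, fun D _ χ hD hq hp => (main D χ hD hq hp).2.1⟩,
    ⟨D₁, fun D _ χ hD hq hp => (main D χ hD hq hp).2.2⟩⟩

/-- **The same edge with Lemma 4.6 (iii) AS PRINTED (open punctured disc) — repair (b) of the second
seam**: from `Lemma42`, `Lemma45R`, Lemma 4.6 on the window `𝓛₁ + 5/2` but with the printed
OPEN punctured disc `0 < |w| < α(1 − c′α𝓛)`, and `Lemma47 c′` as printed, Proposition 2.2 follows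
at every LARGER parameter:
`∀ c″ > c′, Prop22 c″` ((i), (ii) as before; (iii) from `R₋ ≤ γ′ − γ < R₊`, so
`|γ′ − γ − α| ≤ c′α²𝓛 < c″α²𝓛`). [cite: Zhang2022LandauSiegel, §4 p. 23] -/
theorem prop22_of_repaired_open (c' : ℝ) (h42 : Lemma42)
    (h45 : ForAllLarge fun D _ χ => ∀ x ∈ PsiOne χ, ∀ s : ℂ,
      1 / 2 + alpha D ^ 2 ≤ s.re → s.re < 1 → |s.im - 2 * π * t0 D| < ell1 D + 5 / 2 →
        calA χ x s ≠ 0)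
    (h46 : ForAllLarge fun D _ χ => ∀ x ∈ PsiOne χ, ∀ ρ : ℂ, calA χ x ρ = 0 →
      1 / 2 ≤ ρ.re → ρ.re < 1 / 2 + alpha D ^ 2 → |ρ.im - 2 * π * t0 D| < ell1 D + 5 / 2 →
        ρ.re = 1 / 2 ∧ deriv (calA χ x) ρ ≠ 0 ∧
          ∀ w : ℂ, 0 < ‖w‖ → ‖w‖ < alpha D * (1 - c' * alpha D * ell D) → calA χ x (ρ + w) ≠ 0)
    (h47 : Lemma47 c') (c'' : ℝ) (hc : c' < c'') : Prop22 c'' := by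
  obtain ⟨C₂, h2⟩ := h42
  obtain ⟨D₀, hall⟩ := ((h2.and h45).and h46).and h47
  set D₁ : ℕ := max D₀ ⌈Real.exp (3 * Real.pi * |c'| + 4 + 2 * max C₂ 1)⌉₊ with hD₁
  have main : ∀ (D : ℕ) [NeZero D] (χ : DirichletCharacter ℂ D), D₁ ≤ D →
      χ.IsQuadratic → χ.IsPrimitive →
      (∀ x ∈ PsiOne χ, ∀ s ∈ prodZeroSetOmega χ x, s.re = 1 / 2) ∧
      (∀ x ∈ PsiOne χ, ∀ s ∈ prodZeroSetOmega χ x,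
        deriv (fun w => x.ψ.LFunction w * (psiChi χ x).LFunction w) s ≠ 0) ∧
      (∀ x ∈ PsiOne χ, ∀ s ∈ prodZeroSetOmega χ x, ∀ s' ∈ prodZeroSetOmega χ x, s.im < s'.im →
        (∀ s'' ∈ prodZeroSetOmega χ x, ¬ (s.im < s''.im ∧ s''.im < s'.im)) →
          |s'.im - s.im - alpha D| < c'' * alpha D ^ 2 * ell D) := by
    intro D _ χ hD hq hp
    obtain ⟨⟨⟨h42D, h45D⟩, h46D⟩, h47D⟩ := hall D χ (le_trans (le_max_left _ _) hD) hq hp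
    obtain ⟨hD3, hα, hℓ0, hRR, hR_half, hR_log, hlogpos, h227⟩ :=
      edge_thresholds (c' := c') (C₂ := C₂) (le_trans (le_max_right _ _) hD)
    have hF0 : ∀ x ∈ PsiOne χ, ∀ s ∈ Omega1 D, Fpoly χ x s ≠ 0 := by
      intro x hx s hs hF
      have h := h42D x hx s hs
      rw [hF, zero_mul, zero_sub, norm_neg, norm_one] at h
      linarith
    have hx12 : ∀ x ∈ PsiOne χ, _ := fun x hx =>
      parts_i_ii_of_pointwise (x := x) hD3 hp hlogpos (hF0 x hx) (h45D x hx)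
        (fun ρ hA h1 h2 hw => ⟨(h46D x hx ρ hA h1 h2 hw).1, (h46D x hx ρ hA h1 h2 hw).2.1⟩)
    refine ⟨fun x hx => (hx12 x hx).2.1, fun x hx => (hx12 x hx).2.2,
      fun x hx s hs s' hs' hlt hcons => ?_⟩
    obtain ⟨hline, hI, -⟩ := hx12 x hx
    have h3 := part_iii_of_pointwise hα hRR hR_half hR_log (hF0 x hx) hline hI
      (fun ρ hAρ h1 h2 hw => (h46D x hx ρ hAρ h1 h2 hw).2.2) (h47D x hx) hs hs' hlt hcons
    obtain ⟨hge, hlt'⟩ := h3.1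
    have e1 : alpha D * (1 + c' * alpha D * ell D) = alpha D + c' * alpha D ^ 2 * ell D := by ring
    have e2 : alpha D * (1 - c' * alpha D * ell D) = alpha D - c' * alpha D ^ 2 * ell D := by ring
    have hpos : 0 < alpha D ^ 2 * ell D := by positivity
    have hcc : c' * alpha D ^ 2 * ell D < c'' * alpha D ^ 2 * ell D := by nlinarith
    rw [abs_lt]
    constructor <;> linarith
  exact ⟨⟨D₁, fun D _ χ hD hq hp => (main D χ hD hq hp).1⟩,
    ⟨D₁, fun D _ χ hD hq hp => (main D χ hD hq hp).2.1⟩,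
    ⟨D₁, fun D _ χ hD hq hp => (main D χ hD hq hp).2.2⟩⟩

/-! ## The repaired forms imply the banked nodes -/

/-- `Lemma45R → Lemma45`: the closed range `1/2 + α² ≤ σ` and the window `𝓛₁ + 5/2` weaken to the
printed `1/2 + α² < σ`, `𝓛₁ + 2`. [cite: Zhang2022LandauSiegel, §4 Lemma 4.5] -/
theorem lemma45_of_repaired
    (h45 : ForAllLarge fun D _ χ => ∀ x ∈ PsiOne χ, ∀ s : ℂ,
      1 / 2 + alpha D ^ 2 ≤ s.re → s.re < 1 → |s.im - 2 * π * t0 D| < ell1 D + 5 / 2 →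
        calA χ x s ≠ 0) : Lemma45 :=
  h45.mono fun D _ χ _ _ h x hx s h1 h2 h3 => h x hx s h1.le h2 (by linarith)

/-- `Lemma46R c′ → Lemma46 c′`: the window and the closed punctured disc weaken to the printed
forms. [cite: Zhang2022LandauSiegel, §4 Lemma 4.6] -/
theorem lemma46_of_repaired (c' : ℝ)
    (h46 : ForAllLarge fun D _ χ => ∀ x ∈ PsiOne χ, ∀ ρ : ℂ, calA χ x ρ = 0 →
      1 / 2 ≤ ρ.re → ρ.re < 1 / 2 + alpha D ^ 2 → |ρ.im - 2 * π * t0 D| < ell1 D + 5 / 2 →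
        ρ.re = 1 / 2 ∧ deriv (calA χ x) ρ ≠ 0 ∧
          ∀ w : ℂ, 0 < ‖w‖ → ‖w‖ ≤ alpha D * (1 - c' * alpha D * ell D) → calA χ x (ρ + w) ≠ 0) :
    Lemma46 c' :=
  h46.mono fun D _ χ _ _ h x hx ρ hA h1 h2 h3 =>
    have h' := h x hx ρ hA h1 h2 (by linarith)
    ⟨h'.1, h'.2.1, fun w hw0 hw => h'.2.2 w hw0 hw.le⟩

end Literature.NumberTheory.LFunctions.Zhang2022.Skeleton
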